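import Literature.MathematicalPhysics.QuantumLattice.FermionicTreeExpansionKernelDecay
import HarnessLib

/-!
# The single-scale bound for the truncated expectation of kernel-weighted (extended) vertices

Topic `Literature/MathematicalPhysics/QuantumLattice`; the junction (at the level of the scalars, so that this file
only imports the tree estimate) of `GrassmannKernelVertices.lean` (the truncated expectation of kernel-weighted cluster monomials of a
fermion block is `(Σ_x (∏_w K w x) · treeSum_x) · 1`, Benfatto–Giuliani–Mastropietro 2006, (2.31) with
(2.66)) and `FermionicTreeExpansionKernelDecay.lean` (the positional `n!`-free estimate for extended
vertices, loc. cit. (2.77)): the scalar in front of `1` is bounded, one slot of the root cluster being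
pinned, by `|ι|^{|ι|-2} δ^{|F|} (2 n² Γ)^{|ι|-1} ∏_w N w` — Cayley's count of the anchored cluster trees, the
determinant bound `δ` of the block covariance, `2n²` field-line choices and one `L¹–L^∞` propagator norm
`Γ` per tree line, and one `L¹–L^∞` kernel norm `N w` per vertex (Gawȩdzki–Kupiainen 1985; Gentile–
Mastropietro 2001, §4).  This is the single-scale lemma of the multiscale expansion for the part of the
effective potential without external legs; with the lower-scale fields as (even) spectators the same bound
applies coefficientwise (`evenTruncated_spectator_mul`).

* `FermionicTree.norm_sum_kernel_ursellOf_le_of_twoPointBound` — complex kernels: the pinned sum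
  `Σ_{x : x τ₀ = a} (∏_w K w x) 𝓔ᵀ_x(ι)` is bounded through `sum_kernel_norm_ursellOf_moment_le_of_twoPointBound`
  applied to `‖K‖`;
* **`FermionicTree.norm_sum_kernel_treeSum_le`** — the bound for the scalar of
  `evenTruncated_kernelClusters_eq_algebraMap_sum` (propagator `G_x f f' = (A⁻¹)_{lab x(su f), lab x(sb f')}`,
  two-point bound `‖(A⁻¹)_{lab b, lab b'}‖ ≤ h(b, b')` with row and column sums `≤ Γ`).

Everything is proved; no named fact.

## Sources

G. Benfatto, A. Giuliani, V. Mastropietro, Ann. Henri Poincaré 7 (2006) 809–898, (2.31), (2.66)–(2.77)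
(`BenfattoGiulianiMastropietro2006`); K. Gawȩdzki, A. Kupiainen, Comm. Math. Phys. 102 (1985) 1–30, §3
(`GawedzkiKupiainen1985GrossNeveu`); G. Gentile, V. Mastropietro, Phys. Rep. 352 (2001) 273–437, §4
(`GentileMastropietro2001`).
-/

noncomputable section

open Finset Matrix
open Literature.Probability.LatticeModels Literature.Probability.LatticeModels.BattleFederbush
open scoped InnerProductSpace

namespace Literature.MathematicalPhysics.QuantumLattice

namespace FermionicTree

variable {𝕜 : Type*} [RCLike 𝕜]
variable {ι : Type*} [DecidableEq ι] [Fintype ι] {F : Type*} [Fintype F] [LinearOrder F]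
variable {S : Type*} [Fintype S] [DecidableEq S] {Λ : Type*} [AddCommGroup Λ] [Fintype Λ] [DecidableEq Λ]

/-- **Complex kernels**: the pinned kernel-weighted sum of truncated expectations
`Σ_{x : x τ₀ = a} (∏_w K w x) 𝓔ᵀ_x(ι)` is bounded by `|ι|^{|ι|-2} δ^{|F|} (2 n² Γ)^{|ι|-1} ∏_w N w` when the
`L¹–L^∞` norms of the kernels are `≤ N w` (the hypotheses of
`sum_kernel_norm_ursellOf_moment_le_of_twoPointBound` for `‖K‖`). [cite: BenfattoGiulianiMastropietro2006, (2.66)-(2.77)] -/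
theorem norm_sum_kernel_ursellOf_le_of_twoPointBound (c : F → ι) (cS : S → ι)
    (Gx : (S → Λ) → Matrix F F 𝕜) {δ : ℝ} (hδ : 1 ≤ δ)
    (hDB : ∀ (x : S → Λ) (m r : ℕ) (w : Fin r → EuclideanSpace ℝ (Fin m)), (∀ a, ‖w a‖ = 1) →
      ∀ (e : Fin r ↪o F) (c' : ℕ) (ρ γ : Fin c' → Fin r), StrictMono ρ → StrictMono γ →
        ‖(Matrix.of fun a b : Fin c' =>
            ((⟪w (ρ a), w (γ b)⟫_ℝ : ℝ) : 𝕜) * Gx x (e (ρ a)) (e (γ b))).det‖ ≤ δ ^ c')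
    (h2 : Λ → Λ → ℝ) (hh0 : ∀ b b', 0 ≤ h2 b b') {Γ : ℝ} (hrow : ∀ b, ∑ b', h2 b b' ≤ Γ)
    (hcol : ∀ b', ∑ b, h2 b b' ≤ Γ) (sb su : F → S) (hsb : ∀ f, cS (sb f) = c f)
    (hsu : ∀ f, cS (su f) = c f) (hG : ∀ x f f', ‖Gx x f f'‖ ≤ h2 (x (sb f)) (x (su f')))
    (n : ℕ) (hn : ∀ u : ι, (fieldsOf c {u}).card ≤ n)
    (K : ι → (S → Λ) → 𝕜) (hKloc : ∀ u x x', (∀ τ, cS τ = u → x τ = x' τ) → K u x = K u x')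
    (N : ι → ℝ) (hN0 : ∀ u, 0 ≤ N u)
    (hKN : ∀ u τ, cS τ = u → ∀ a : Λ,
      ∑ x ∈ univ.filter (fun x : S → Λ => x τ = a ∧ ∀ τ', cS τ' ≠ u → x τ' = 0), ‖K u x‖ ≤ N u)
    {v : ι} (τ₀ : S) (hτ₀ : cS τ₀ = v) (a : Λ) :
    ‖∑ x ∈ univ.filter (fun x : S → Λ => x τ₀ = a), (∏ u, K u x) * ursellOf (moment c (Gx x)) univ‖ ≤
      (Fintype.card ι : ℝ) ^ (Fintype.card ι - 2) *
        (δ ^ Fintype.card F * (2 * (n : ℝ) ^ 2 * Γ) ^ (Fintype.card ι - 1)) * ∏ u, N u := by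
  refine (norm_sum_le _ _).trans ?_
  refine le_trans (sum_le_sum fun x _ => ?_)
    (sum_kernel_norm_ursellOf_moment_le_of_twoPointBound c cS Gx hδ hDB h2 hh0 hrow hcol sb su hsb hsu hG
      n hn (fun u x => ‖K u x‖) (fun u x => norm_nonneg _)
      (fun u x x' hxx' => by rw [hKloc u x x' hxx']) N hN0 hKN τ₀ hτ₀ a)
  rw [norm_mul, norm_prod]

variable {n : Type*}

/-- **The single-scale bound for kernel-weighted vertices of a fermion block** (Benfatto–Giuliani–
Mastropietro 2006, (2.77) for general effective vertices): the scalar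
`Σ_{x : x τ₀ = a} (∏_w K w x) treeSum_x` of `evenTruncated_kernelClusters_eq_algebraMap_sum` (pinned at one
slot `τ₀` of the root cluster `v`; propagator `G_x f f' = (A⁻¹)_{lab x(su f), lab x(sb f')}`) is bounded by
`|ι|^{|ι|-2} δ^{|F|} (2 n² Γ)^{|ι|-1} ∏_w N w`, given a position-uniform determinant bound `δ` for the
Gram-weighted minors of the `G_x`, a two-point bound `‖(A⁻¹)_{lab b, lab b'}‖ ≤ h(b, b')` with row and column
sums `≤ Γ`, kernels with `L¹–L^∞` norms `≤ N w`, and at most `n₀` field pairs per cluster.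
[cite: BenfattoGiulianiMastropietro2006, (2.66)-(2.77)] -/
theorem norm_sum_kernel_treeSum_le (c : F → ι) (cS : S → ι) (Ainv : Matrix n n 𝕜) (lab : Λ → n)
    (sb su : F → S) (hsb : ∀ f, cS (sb f) = c f) (hsu : ∀ f, cS (su f) = c f) {δ : ℝ} (hδ : 1 ≤ δ)
    (hDB : ∀ (x : S → Λ) (m r : ℕ) (w : Fin r → EuclideanSpace ℝ (Fin m)), (∀ a, ‖w a‖ = 1) →
      ∀ (e : Fin r ↪o F) (c' : ℕ) (ρ γ : Fin c' → Fin r), StrictMono ρ → StrictMono γ →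
        ‖(Matrix.of fun a b : Fin c' => ((⟪w (ρ a), w (γ b)⟫_ℝ : ℝ) : 𝕜) *
            Ainv (lab (x (su (e (ρ a))))) (lab (x (sb (e (γ b)))))).det‖ ≤ δ ^ c')
    (h2 : Λ → Λ → ℝ) (hh0 : ∀ b b', 0 ≤ h2 b b') {Γ : ℝ} (hrow : ∀ b, ∑ b', h2 b b' ≤ Γ)
    (hcol : ∀ b', ∑ b, h2 b b' ≤ Γ) (hA : ∀ b b', ‖Ainv (lab b) (lab b')‖ ≤ h2 b b')
    (n₀ : ℕ) (hn : ∀ u : ι, (fieldsOf c {u}).card ≤ n₀)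
    (K : ι → (S → Λ) → 𝕜) (hKloc : ∀ u x x', (∀ τ, cS τ = u → x τ = x' τ) → K u x = K u x')
    (N : ι → ℝ) (hN0 : ∀ u, 0 ≤ N u)
    (hKN : ∀ u τ, cS τ = u → ∀ a : Λ,
      ∑ x ∈ univ.filter (fun x : S → Λ => x τ = a ∧ ∀ τ', cS τ' ≠ u → x τ' = 0), ‖K u x‖ ≤ N u)
    {v : ι} (τ₀ : S) (hτ₀ : cS τ₀ = v) (a : Λ) :
    ‖∑ x ∈ univ.filter (fun x : S → Λ => x τ₀ = a), (∏ u, K u x) *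
        treeSum c (Matrix.of fun f f' => Ainv (lab (x (su f))) (lab (x (sb f')))) v univ‖ ≤
      (Fintype.card ι : ℝ) ^ (Fintype.card ι - 2) *
        (δ ^ Fintype.card F * (2 * (n₀ : ℝ) ^ 2 * Γ) ^ (Fintype.card ι - 1)) * ∏ u, N u := by
  have h := norm_sum_kernel_ursellOf_le_of_twoPointBound c cS
    (fun x => Matrix.of fun f f' => Ainv (lab (x (su f))) (lab (x (sb f')))) hδ
    (fun x m r w hw e c' ρ γ hρ hγ => by simpa only [Matrix.of_apply] using hDB x m r w hw e c' ρ γ hρ hγ)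
    h2 hh0 hrow hcol su sb hsu hsb (fun x f f' => by rw [Matrix.of_apply]; exact hA _ _) n₀ hn K hKloc N
    hN0 hKN τ₀ hτ₀ a
  refine le_trans (le_of_eq ?_) h
  congr 1
  refine sum_congr rfl fun x _ => ?_
  rw [ursellOf_moment_eq_treeSum c _ univ (mem_univ v)]

end FermionicTree

end Literature.MathematicalPhysics.QuantumLattice
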